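import Summits.QuantumFields.BalabanUV.T4Continuum.Support.VariationalTowerDefect
import Literature.MathematicalPhysics.QuantumFieldTheory.Balaban1983to89.Beta.FluctuationProjection

/-!
# T⁴ programme, spine node NE2 (U1a), lane P2 — LOCATED FINDING G-ne2leaf04g2-1, appendix: IN-BLOCK RECTANGLE HOLONOMIES UNDER THE TOWER
# END's HYPOTHESES are `≤ perimeter × c₁L²/(L²−1)·(L^k)^{−2}` (the in-block version of `VariationalTowerDefect.norm_rect_sub_one_le_perimeter`)

NE2 formalisation swarm `b2b-balaban-t4-ne2-formalise-*`, leaf 04 GEN 2 (`prover-b2b-balaban-t4-ne2-formalise-leaf-04-g2-0`); sequel of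
`VariationalTowerDefect` (p214848; GAPS G-ne2leaf04g2-1, journal l.10732).  That file proves, in the letters of the road owner's END
`VariationalCovariantEnd.towerLimitRate_scalarTower_closed` (p213959), that COMP⁺ + ONE⁺'s face binder + UB⁺'s in-block binder + the CLASS force
every IN-BLOCK transport defect at level `k` below `c₁·L²/(L²−1)·(L^k)^{−2}` (`inBlock_defect_le_of_class`), and — under a defect bound on ALL
bonds — `‖rect − 1‖ ≤ 2(m+ℓ)·w`.  THIS FILE removes the word ALL: §1 digit arithmetic inside a block (the tree's `Beta.FluctuationProjection.bpt_add_tstep_of_lt`), §2 the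
straight transport and the rectangle with the defect bound assumed ONLY on the bonds they use (`norm_piT_sub_one_le_on`,
`norm_rect_sub_one_le_perimeter_on`), §3 **`norm_rect_sub_one_le_of_inBlock`**: a defect bound on the IN-BLOCK bonds (the END's `hwin` shape) bounds
every in-block rectangle, and **`rect_holonomy_le_of_class`**: under the END's hypotheses (+ unit `Rc`), for every level `k`, block `z`, base offset
`j₀`, directions `μ ≠ ν` and sides with `j₀_μ + m < L^k`, `j₀_ν + ℓ < L^k`,

  `‖rect (Rc k) (bpt (L^k) M z j₀) μ m ν ℓ − 1‖ ≤ 2(m+ℓ) · c₁L²/(L²−1) · (L^k)^{−2}`.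

READING (prose): a rectangle of physical sides `s₁, s₂` inside a unit block has `m = s₁L^k`, `ℓ = s₂L^k`, so its level-`k` holonomy is within
`2(s₁+s₂)c₁L²/(L²−1)·L^{−k}` of `1`.  For tower data that are the exact bond transports of ONE continuum U(1) connection (abelian line integrals:
the lattice rectangle holonomy IS `exp(i·flux)` at every level), the flux through every in-block rectangle is therefore `0 mod 2π`, i.e. the
connection is FLAT inside every unit block; for general lattice towers the statement is asymptotic in-block flatness at rate `L^{−k}`.  (FED⁺'s
`hmis` additionally ties consecutive levels, `|hol_k − hol_{k+1}| ≤ perimeter·m_k`; it is not needed for the above.)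

HONEST FRAMING (T4-DAG p. 1).  [folklore] abelian bookkeeping at MODEL level; a satisfiability statement about a hypothesis set, NOT a refutation
of any tree theorem; nothing printed is a hypothesis; no `def`; no `sorry`; axioms standard.  NE2 NOT proved, NOT refuted; spine 0/9; rung (B)+1
finite T⁴ — NOT infinite volume, NOT mass gap, NOT Clay.  HONEST DEPENDENCY (cell, verbatim): continuum YM on T⁴ ⇐ BetaPertH ∧ nine spine
estimates (0/9 proved); BetaPertH ⇐ (D1) ∧ (D4) ∧ CAP+tail; G-an2-4 gates asym, D1 and NE2/3/4.
-/

noncomputable section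

open scoped BigOperators ComplexConjugate
open Finset

namespace Summit.QuantumFields.BalabanUV.T4Continuum.VariationalTowerDefectRect

open Literature.MathematicalPhysics.QuantumFieldTheory.Balaban1983to89.B5Prop11Plancherel (Tor fine unitVec)
open Literature.MathematicalPhysics.QuantumFieldTheory.Balaban1983to89.B5Block118 (tstep tstep_zero tstep_succ bpt)
open Literature.MathematicalPhysics.QuantumFieldTheory.Balaban1983to89.Beta.FluctuationProjection (bpt_add_tstep_of_lt)
open Summit.QuantumFields.BalabanUV.T4Continuum.VariationalCovariantFederbush (piT)
open Summit.QuantumFields.BalabanUV.T4Continuum.VariationalCovariantUpperBound (mul_conj_of_norm_one)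
open Summit.QuantumFields.BalabanUV.T4Continuum.VariationalCovariantTower (compT Rtr)
open Summit.QuantumFields.BalabanUV.T4Continuum.VariationalTaxiTransport (norm_piT)
open Summit.QuantumFields.BalabanUV.T4Continuum.VariationalTaxiCoarse (rect piT_mul_piT_shift)
open Summit.QuantumFields.BalabanUV.T4Continuum.VariationalTaxiCoarseBinders (norm_mul_sub_one_le)
open Summit.QuantumFields.BalabanUV.T4Continuum.VariationalTowerDefect
  (gaugeR norm_gaugeR rect_gaugeR inBlock_defect_le_of_class)

variable {d : ℕ}

/-! ## §1 Digit arithmetic inside a block: the tree's `Beta.FluctuationProjection.bpt_add_tstep_of_lt` (imported) -/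

/-! ## §2 Straight transports and rectangles with the defect bound on their own bonds only -/

section Local

variable (L : ℕ) [NeZero L] (N : Fin d → ℕ) [hN : ∀ μ, NeZero (N μ)]

omit [NeZero L] hN in
/-- a straight transport of `r` unit bonds, each within `w` of `1`, is within `r·w` of `1` (bound needed on those `r` bonds only). [folklore] -/
theorem norm_piT_sub_one_le_on {S : Tor (fine L N) → Fin d → ℂ} (hS1 : ∀ x κ, ‖S x κ‖ = 1) {w : ℝ} (q : Tor (fine L N)) (κ : Fin d)
    (r : ℕ) (hS : ∀ t, t < r → ‖S (q + tstep (fine L N) κ t) κ - 1‖ ≤ w) : ‖piT L N S q κ r - 1‖ ≤ (r : ℝ) * w := by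
  induction r with
  | zero => simp [piT]
  | succ r ih =>
    have e : piT L N S q κ (r + 1) - 1 = piT L N S q κ r * (S (q + tstep (fine L N) κ r) κ - 1) + (piT L N S q κ r - 1) := by
      simp only [piT]; ring
    rw [e]
    refine (norm_add_le _ _).trans ?_
    rw [norm_mul, norm_piT L N hS1, one_mul, Nat.cast_succ]
    have h1 := hS r (Nat.lt_succ_self r)
    have h2 := ih fun t ht => hS t (Nat.lt_succ_of_lt ht)
    linarith

variable {R : Tor (fine L N) → Fin d → ℂ} (hR1 : ∀ x μ, ‖R x μ‖ = 1) {T : Tor (fine L N) → ℂ} (hT1 : ∀ x, ‖T x‖ = 1)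
include hR1 hT1

omit [NeZero L] hN in
/-- **HOLONOMY ≤ PERIMETER × DEFECT, local form**: the defect bound `‖R(x,κ)·conj T(x+e_κ)·T(x) − 1‖ ≤ w` is assumed ONLY on the `2(m+ℓ)`
boundary bonds of the rectangle. [folklore] -/
theorem norm_rect_sub_one_le_perimeter_on {w : ℝ} (p : Tor (fine L N)) (μ ν : Fin d) (m ℓ : ℕ)
    (hbot : ∀ s, s < m → ‖gaugeR L N R T (p + tstep (fine L N) μ s) μ - 1‖ ≤ w)
    (hright : ∀ t, t < ℓ → ‖gaugeR L N R T (p + tstep (fine L N) μ m + tstep (fine L N) ν t) ν - 1‖ ≤ w)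
    (htop : ∀ s, s < m → ‖gaugeR L N R T (p + tstep (fine L N) ν ℓ + tstep (fine L N) μ s) μ - 1‖ ≤ w)
    (hleft : ∀ t, t < ℓ → ‖gaugeR L N R T (p + tstep (fine L N) ν t) ν - 1‖ ≤ w) :
    ‖rect L N R p μ m ν ℓ - 1‖ ≤ 2 * ((m : ℝ) + ℓ) * w := by
  have hS1 : ∀ x κ, ‖gaugeR L N R T x κ‖ = 1 := norm_gaugeR L N hR1 hT1
  rw [← rect_gaugeR L N hT1 p μ m ν ℓ]
  have hst := piT_mul_piT_shift L N hS1 p μ ν m ℓ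
  have nEC : ‖piT L N (gaugeR L N R T) p ν ℓ * piT L N (gaugeR L N R T) (p + tstep (fine L N) ν ℓ) μ m‖ = 1 := by
    rw [norm_mul, norm_piT L N hS1, norm_piT L N hS1, mul_one]
  have u := (mul_conj_of_norm_one nEC).1
  have key : rect L N (gaugeR L N R T) p μ m ν ℓ
      = piT L N (gaugeR L N R T) p μ m * piT L N (gaugeR L N R T) (p + tstep (fine L N) μ m) ν ℓ
        * conj (piT L N (gaugeR L N R T) p ν ℓ * piT L N (gaugeR L N R T) (p + tstep (fine L N) ν ℓ) μ m) := by
    linear_combination (-(conj (piT L N (gaugeR L N R T) p ν ℓ * piT L N (gaugeR L N R T) (p + tstep (fine L N) ν ℓ) μ m))) * hst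
      - rect L N (gaugeR L N R T) p μ m ν ℓ * u
  rw [key]
  have hA := norm_piT_sub_one_le_on L N hS1 p μ m hbot
  have hB := norm_piT_sub_one_le_on L N hS1 (p + tstep (fine L N) μ m) ν ℓ hright
  have hC := norm_piT_sub_one_le_on L N hS1 (p + tstep (fine L N) ν ℓ) μ m htop
  have hE := norm_piT_sub_one_le_on L N hS1 p ν ℓ hleft
  have nA : ‖piT L N (gaugeR L N R T) p μ m‖ = 1 := norm_piT L N hS1 _ _ _
  have nE : ‖piT L N (gaugeR L N R T) p ν ℓ‖ = 1 := norm_piT L N hS1 _ _ _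
  have nAB : ‖piT L N (gaugeR L N R T) p μ m * piT L N (gaugeR L N R T) (p + tstep (fine L N) μ m) ν ℓ‖ = 1 := by
    rw [norm_mul, nA, norm_piT L N hS1, mul_one]
  have hconj : ∀ z : ℂ, ‖conj z - 1‖ = ‖z - 1‖ := fun z => by rw [← Complex.norm_conj (z - 1), map_sub, map_one]
  calc _ ≤ ‖piT L N (gaugeR L N R T) p μ m * piT L N (gaugeR L N R T) (p + tstep (fine L N) μ m) ν ℓ - 1‖
          + ‖conj (piT L N (gaugeR L N R T) p ν ℓ * piT L N (gaugeR L N R T) (p + tstep (fine L N) ν ℓ) μ m) - 1‖ :=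
        norm_mul_sub_one_le nAB
    _ ≤ (‖piT L N (gaugeR L N R T) p μ m - 1‖ + ‖piT L N (gaugeR L N R T) (p + tstep (fine L N) μ m) ν ℓ - 1‖)
          + (‖piT L N (gaugeR L N R T) p ν ℓ - 1‖ + ‖piT L N (gaugeR L N R T) (p + tstep (fine L N) ν ℓ) μ m - 1‖) := by
        rw [hconj]
        exact add_le_add (norm_mul_sub_one_le nA) (norm_mul_sub_one_le nE)
    _ ≤ ((m : ℝ) * w + ℓ * w) + (ℓ * w + m * w) := add_le_add (add_le_add hA hB) (add_le_add hE hC)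
    _ = 2 * ((m : ℝ) + ℓ) * w := by ring

end Local

/-! ## §3 In-block rectangles under an in-block defect bound, and under the END's hypotheses -/

section InBlock

variable (n : ℕ) [NeZero n] (M : Fin d → ℕ) [hM : ∀ μ, NeZero (M μ)]
variable {Rc : Tor (fine n M) → Fin d → ℂ} (hRc1 : ∀ x μ, ‖Rc x μ‖ = 1) {T : Tor (fine n M) → ℂ} (hT1 : ∀ x, ‖T x‖ = 1)
include hRc1 hT1

omit [NeZero n] hM in
/-- **IN-BLOCK RECTANGLES**: a defect bound on the IN-BLOCK bonds (UB⁺'s `hwin` shape: `y = bpt n M z j`, `j_κ + 1 < n`) bounds every rectangle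
that stays inside the block: base offset `j₀`, sides `m` in direction `μ` and `ℓ` in direction `ν ≠ μ` with `j₀_μ + m < n`, `j₀_ν + ℓ < n`. [folklore] -/
theorem norm_rect_sub_one_le_of_inBlock {w : ℝ}
    (hwin : ∀ (z : Tor M) (j : Fin d → Fin n) (κ : Fin d), (j κ : ℕ) + 1 < n →
      ‖Rc (bpt n M z j) κ * conj (T (bpt n M z j + unitVec (fine n M) κ)) * T (bpt n M z j) - 1‖ ≤ w)
    (z : Tor M) (j₀ : Fin d → Fin n) {μ ν : Fin d} (hμν : μ ≠ ν) (m ℓ : ℕ) (hm : (j₀ μ : ℕ) + m < n) (hℓ : (j₀ ν : ℕ) + ℓ < n) :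
    ‖rect n M Rc (bpt n M z j₀) μ m ν ℓ - 1‖ ≤ 2 * ((m : ℝ) + ℓ) * w := by
  -- every bond used is `bpt z j` with an in-block digit in its own direction
  have hD : ∀ (j : Fin d → Fin n) (κ : Fin d), (j κ : ℕ) + 1 < n → ‖gaugeR n M Rc T (bpt n M z j) κ - 1‖ ≤ w :=
    fun j κ h => hwin z j κ h
  refine norm_rect_sub_one_le_perimeter_on n M hRc1 hT1 (bpt n M z j₀) μ ν m ℓ ?_ ?_ ?_ ?_
  · intro s hs
    rw [bpt_add_tstep_of_lt n M z j₀ μ s (by omega)]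
    exact hD _ μ (by simp; omega)
  · intro t ht
    have hν : ((Function.update j₀ μ ⟨(j₀ μ : ℕ) + m, hm⟩) ν : ℕ) = (j₀ ν : ℕ) := by
      rw [Function.update_of_ne (Ne.symm hμν)]
    rw [bpt_add_tstep_of_lt n M z j₀ μ m hm, bpt_add_tstep_of_lt n M z _ ν t (by rw [hν]; omega)]
    exact hD _ ν (by simp [Function.update_of_ne (Ne.symm hμν)]; omega)
  · intro s hs
    have hμ : ((Function.update j₀ ν ⟨(j₀ ν : ℕ) + ℓ, hℓ⟩) μ : ℕ) = (j₀ μ : ℕ) := by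
      rw [Function.update_of_ne hμν]
    rw [bpt_add_tstep_of_lt n M z j₀ ν ℓ hℓ, bpt_add_tstep_of_lt n M z _ μ s (by rw [hμ]; omega)]
    exact hD _ μ (by simp [Function.update_of_ne hμν]; omega)
  · intro t ht
    rw [bpt_add_tstep_of_lt n M z j₀ ν t (by omega)]
    exact hD _ ν (by simp; omega)

end InBlock

section End

variable (L : ℕ) [NeZero L] (M : Fin d → ℕ) [hM : ∀ μ, NeZero (M μ)]
variable (Rc : (k : ℕ) → Tor (fine (L ^ k) M) → Fin d → ℂ) (T : (k : ℕ) → Tor (fine (L ^ k) M) → ℂ)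
variable (R' : (k : ℕ) → Tor (fine L (fine (L ^ k) M)) → Fin d → ℂ) (T' : (k : ℕ) → Tor (fine L (fine (L ^ k) M)) → ℂ)

/-- **UNDER THE TOWER END's HYPOTHESES EVERY IN-BLOCK RECTANGLE HOLONOMY IS `≤ perimeter × c₁L²/(L²−1)·(L^k)^{−2}`** (letters of
`VariationalCovariantEnd.towerLimitRate_scalarTower_closed`: COMP⁺, unit `T` and `Rc`, ONE⁺'s `hcross ≤ m₁`, UB⁺'s `hwin ≤ w`, CLASS, `L ≥ 2`):
for directions `μ ≠ ν`, base offset `j₀` and sides with `j₀_μ + m < L^k`, `j₀_ν + ℓ < L^k`.  A physical in-block rectangle (`m, ℓ ≍ L^k`) thus has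
holonomy within `O(L^{−k})` of `1` at level `k` — asymptotic in-block flatness; exact flatness for the bond transports of one continuum connection.
[folklore] -/
theorem rect_holonomy_le_of_class (hL : 2 ≤ L) (hT : ∀ k x, ‖T k x‖ = 1) (hRc1 : ∀ k y μ, ‖Rc k y μ‖ = 1)
    (hTcomp : ∀ k, T (k + 1) = compT (L ^ k) L M (T k) (T' k)) (hRtr : ∀ k, Rc (k + 1) = Rtr (L ^ k) L M (R' k))
    {m₁ w : ℕ → ℝ} (hm₁ : ∀ k, 0 ≤ m₁ k)
    (hcross : ∀ k (y : Tor (fine (L ^ k) M)) (j : Fin d → Fin L) (μ : Fin d), (j μ : ℕ) + 1 = L →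
      ‖R' k (bpt L (fine (L ^ k) M) y j) μ * conj (T' k (bpt L (fine (L ^ k) M) y j + unitVec (fine L (fine (L ^ k) M)) μ))
          * T' k (bpt L (fine (L ^ k) M) y j) - Rc k y μ‖ ≤ m₁ k)
    (hwin : ∀ k (z : Tor M) (j : Fin d → Fin (L ^ k)) (μ : Fin d), (j μ : ℕ) + 1 < L ^ k →
      ‖Rc k (bpt (L ^ k) M z j) μ * conj (T k (bpt (L ^ k) M z j + unitVec (fine (L ^ k) M) μ)) * T k (bpt (L ^ k) M z j) - 1‖
        ≤ w k)
    {cw c₁ : ℝ} (hwc : ∀ k, (((L ^ k : ℕ)) : ℝ) * w k ≤ cw) (hm₁c : ∀ k, (((L ^ k : ℕ)) : ℝ) ^ 2 * m₁ k ≤ c₁)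
    (k : ℕ) (z : Tor M) (j₀ : Fin d → Fin (L ^ k)) {μ ν : Fin d} (hμν : μ ≠ ν) (m ℓ : ℕ)
    (hm : (j₀ μ : ℕ) + m < L ^ k) (hℓ : (j₀ ν : ℕ) + ℓ < L ^ k) :
    ‖rect (L ^ k) M (Rc k) (bpt (L ^ k) M z j₀) μ m ν ℓ - 1‖
      ≤ 2 * ((m : ℝ) + ℓ) * (c₁ * ((L : ℝ) ^ 2 / ((L : ℝ) ^ 2 - 1)) * ((((L ^ k : ℕ)) : ℝ) ^ 2)⁻¹) :=
  norm_rect_sub_one_le_of_inBlock (L ^ k) M (hRc1 k) (hT k)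
    (fun z' j κ h => inBlock_defect_le_of_class L M Rc T R' T' hL hT hTcomp hRtr hm₁ hcross hwin hwc hm₁c k z' j κ h) z j₀ hμν m ℓ hm hℓ

end End

end Summit.QuantumFields.BalabanUV.T4Continuum.VariationalTowerDefectRect

end
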